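import Summits.CriticalPhenomena.PercolationContinuityZ3.Theorems.PercNearOneGluingNoHeavyLowerTailSahiLatinDescent
import Summits.CriticalPhenomena.PercolationContinuityZ3.Theorems.PercNearOneGluingNoHeavyLowerTailSahiLatinHarris
import Summits.CriticalPhenomena.PercolationContinuityZ3.Theorems.PercNearOneGluingNoHeavyLowerTailSahiCombHarrisEq

/-!
# `NoHeavyLowerTail` (crux stmt-CriticalPhenomena-4575), Sahi programme (prim-master-conj gen 43): ZEROS of the Latin kernel `κ_d`, I —
# the equality cases of the move lemmas R and A, and the RIGIDITY of zeros under FBP (every dimension)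

Support file (`--supports stmt-CriticalPhenomena-4575`; companion of `…SahiLatinKernel/Moves/Descent/Harris`, prim-master-conj gen 42;
sequel `…SahiLatinZeroDescent` (the descent as a reachability relation, independent triples, conjecture TZ); memo
`run/shared/lean/prim/prim-l12/FROM-prim-master-conj-g43-ZERO-LOCUS.md`).  Vocabulary: `Pt ι = ι → Fin 3`, the Latin kernel
`kappa a b c : ℤ` (= the Sahi cell's pattern functional `sStarD` for `ι = Fin d`, `…SahiLatinDictionary`), the charge `Phi b c u`
(`kappa a b c = Σ_{u ∈ a} Phi b c u`), the link counts `N s u`, `Lam b c u`, the trace families `fam u s ⊆ 2^ι` of `…SahiLatinMoves`,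
`IsMinOf`/`IsMaxOut`/`UpTriple`/`LatinPos` of `…SahiLatinDescent`.

THE MATHEMATICS (all `d`; everything PROVED, axioms standard).
1. EQUALITY CASES OF THE MOVE LEMMAS (no monotonicity needed except in the outer cell):
   * `u ∈ b ∩ c`: `Φ_{bc}(u) = (2^d − N_{b∩c}(u)) + (2^d + Λ − N_b − N_c)`, both brackets `≥ 0` (`Phi_of_mem`);
     **`Phi_eq_zero_iff_of_mem`**: `Φ_{bc}(u) = 0 ⟺` the whole link of `u` lies in `b ∩ c`.
   * `u ∈ b ∖ c`: `Φ = −N_{b∩c} − (N_c − Λ)`, both terms `≤ 0` (`Phi_of_mem_of_not_mem`); **`Phi_eq_zero_iff_of_mem_of_not_mem`**: `Φ = 0 ⟺`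
     no link point lies in `b ∩ c` AND every link point whose Latin completion lies in `c` lies in `b` (`Phi_comm` for `u ∈ c ∖ b`).
   * `u ∉ b ∪ c`: `Φ = Λ_{bc}(u) − N_{b∩c}(u)` = minus KLEITMAN'S GAP of the traces of `b, c` on the link cube (`Phi_of_not_mem_of_not_mem`);
     **`inessential_or_of_Phi_eq_zero`**: for up-sets, `Φ = 0 ⟹` every axis is inessential for the trace of `b` or for the trace of `c` on
     `link(u)` (the tree's equality case of Harris–Kleitman, `FiveUpSet.inessential_or_of_kleitman_eq`, seat prim-lf-1).
2. RIGIDITY OF ZEROS UNDER FBP (`LatinPos ι`): at a zero of `κ` every available R-move and every available A-move is COST-FREE and lands on a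
   zero (`Phi_eq_zero_of_isMinOf`, `Phi_eq_zero_of_isMaxOut`); hence (`link_subset_of_isMinOf_of_zero`) the whole link of every minimal element
   of `a` lying in `b ∩ c` lies in `b ∩ c`, and (`inessential_or_of_isMaxOut_of_zero`, `link_structure_of_isMaxOut_of_zero`) the structure of
   item 1 at every maximal non-element of `a` outside `b ∩ c`; the same in the other slots by the slot symmetry of `κ`.
USE (memo §2): these are the local rules generating the ZERO LOCUS of the polarised kernel from the pairwise independent triples (`d = 3`: all
16 932 ordered zeros with proper members are connected to the independent ones by cost-free single-point moves; 810 of them have no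
independent pair).  HONEST LABEL: FBP (`LatinPos ι`, `|ι| ≥ 5`) is OPEN and enters only as a hypothesis. [this work]
-/

namespace Summit.CriticalPhenomena.PercolationContinuityZ3.Theorems.SahiLatin

open Finset

variable {ι : Type*} [Fintype ι] [DecidableEq ι]

/-! ## §1  Equality cases of the move lemmas -/

/-- `Λ_{bc}(u) ≤ N_c(u)` (the completion of a counted link point lies in `c`). [this work] -/
theorem Lam_le_N_right (b c : Finset (Pt ι)) (u : Pt ι) : Lam b c u ≤ N c u := by
  rw [← card_filter_anti_mem c u, Lam]
  exact card_le_card fun y hy => by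
    rw [mem_filter] at hy ⊢
    exact ⟨hy.1, hy.2.2⟩

/-- `Λ_{bc}(u) ≤ N_b(u)`. [this work] -/
theorem Lam_le_N_left (b c : Finset (Pt ι)) (u : Pt ι) : Lam b c u ≤ N b u := by
  rw [Lam, N]
  exact card_le_card fun y hy => by
    rw [mem_filter] at hy ⊢
    exact ⟨hy.1, hy.2.1⟩

/-- `Λ` is symmetric: `Λ_{bc}(u) = Λ_{cb}(u)` (the Latin completion is an involution of the link). [this work] -/
theorem Lam_comm (b c : Finset (Pt ι)) (u : Pt ι) : Lam b c u = Lam c b u := by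
  unfold Lam
  have h : ((link u).filter fun y => y ∈ c ∧ anti u y ∈ b) =
      ((link u).filter fun y => y ∈ b ∧ anti u y ∈ c).image (anti u) := by
    ext y
    simp only [mem_filter, mem_image]
    constructor
    · rintro ⟨hy, hyc, hyb⟩
      exact ⟨anti u y, ⟨anti_mem_link hy, hyb, by rw [anti_anti]; exact hyc⟩, anti_anti u y⟩
    · rintro ⟨z, ⟨hz, hzb, hzc⟩, rfl⟩
      exact ⟨anti_mem_link hz, hzc, by rw [anti_anti]; exact hzb⟩
  rw [h, card_image_of_injective _ (anti_injective u)]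

/-- The charge is symmetric in the two reference sets: `Φ_{bc} = Φ_{cb}`. [this work] -/
theorem Phi_comm (b c : Finset (Pt ι)) (u : Pt ι) : Phi b c u = Phi c b u := by
  rw [Phi_eq, Phi_eq, inter_comm, Lam_comm]; ring

/-- `N_s(u) = 2^d` iff the whole link of `u` lies in `s`. [this work] -/
theorem N_eq_iff_link_subset (s : Finset (Pt ι)) (u : Pt ι) :
    N s u = 2 ^ Fintype.card ι ↔ ∀ y ∈ link u, y ∈ s := by
  rw [N, ← card_link u, Finset.card_filter_eq_iff]

/-- `N_s(u) = 0` iff no link point of `u` lies in `s`. [this work] -/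
theorem N_eq_zero_iff (s : Finset (Pt ι)) (u : Pt ι) : N s u = 0 ↔ ∀ y ∈ link u, y ∉ s := by
  rw [N, Finset.card_eq_zero, filter_eq_empty_iff]

/-- **Lemma R, closed form**: for `u ∈ b ∩ c`, `Φ_{bc}(u) = (2^d − N_{b∩c}(u)) + (2^d + Λ_{bc}(u) − N_b(u) − N_c(u))` — two nonnegative
brackets (`N_le`, Bonferroni `N_add_N_le_Lam_add`). [this work] -/
theorem Phi_of_mem {b c : Finset (Pt ι)} {u : Pt ι} (hb : u ∈ b) (hc : u ∈ c) :
    Phi b c u = (2 ^ Fintype.card ι - (N (b ∩ c) u : ℤ)) + (2 ^ Fintype.card ι + (Lam b c u : ℤ) - N b u - N c u) := by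
  rw [Phi_eq, ind_of_mem hb, ind_of_mem hc, pow_succ]; ring

/-- **EQUALITY CASE OF LEMMA R** (all `d`, no monotonicity needed): for `u ∈ b ∩ c`, `Φ_{bc}(u) = 0` iff the whole link of `u` lies in
`b ∩ c`. [this work] -/
theorem Phi_eq_zero_iff_of_mem {b c : Finset (Pt ι)} {u : Pt ι} (hb : u ∈ b) (hc : u ∈ c) :
    Phi b c u = 0 ↔ ∀ y ∈ link u, y ∈ b ∧ y ∈ c := by
  have h1 : (N b u : ℤ) + N c u ≤ Lam b c u + 2 ^ Fintype.card ι := by exact_mod_cast N_add_N_le_Lam_add b c u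
  have h2 : (N (b ∩ c) u : ℤ) ≤ 2 ^ Fintype.card ι := by exact_mod_cast N_le (b ∩ c) u
  constructor
  · intro h0
    rw [Phi_of_mem hb hc] at h0
    have hN : N (b ∩ c) u = 2 ^ Fintype.card ι := by
      have : (N (b ∩ c) u : ℤ) = 2 ^ Fintype.card ι := by linarith
      exact_mod_cast this
    intro y hy
    exact mem_inter.1 ((N_eq_iff_link_subset (b ∩ c) u).1 hN y hy)
  · intro h
    have hNbc : N (b ∩ c) u = 2 ^ Fintype.card ι := (N_eq_iff_link_subset _ u).2 fun y hy => mem_inter.2 (h y hy)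
    have hNb : N b u = 2 ^ Fintype.card ι := (N_eq_iff_link_subset _ u).2 fun y hy => (h y hy).1
    have hNc : N c u = 2 ^ Fintype.card ι := (N_eq_iff_link_subset _ u).2 fun y hy => (h y hy).2
    have hL : Lam b c u = 2 ^ Fintype.card ι := by
      rw [Lam, ← card_link u, Finset.card_filter_eq_iff]
      intro y hy
      exact ⟨(h y hy).1, (h _ (anti_mem_link hy)).2⟩
    rw [Phi_of_mem hb hc, hNbc, hNb, hNc, hL]; push_cast; ring

/-- **Lemma A, closed form, mixed cell**: for `u ∈ b ∖ c`, `Φ_{bc}(u) = −N_{b∩c}(u) − (N_c(u) − Λ_{bc}(u))` — two nonpositive terms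
(`Lam_le_N_right`). [this work] -/
theorem Phi_of_mem_of_not_mem {b c : Finset (Pt ι)} {u : Pt ι} (hb : u ∈ b) (hc : u ∉ c) :
    Phi b c u = -(N (b ∩ c) u : ℤ) - ((N c u : ℤ) - Lam b c u) := by
  rw [Phi_eq, ind_of_mem hb, ind_of_not_mem hc]; ring

/-- **EQUALITY CASE OF LEMMA A, mixed cell** (all `d`, no monotonicity needed): for `u ∈ b ∖ c`, `Φ_{bc}(u) = 0` iff no link point of `u`
lies in `b ∩ c` and every link point whose Latin completion lies in `c` lies in `b`. [this work] -/
theorem Phi_eq_zero_iff_of_mem_of_not_mem {b c : Finset (Pt ι)} {u : Pt ι} (hb : u ∈ b) (hc : u ∉ c) :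
    Phi b c u = 0 ↔ (∀ y ∈ link u, ¬ (y ∈ b ∧ y ∈ c)) ∧ (∀ y ∈ link u, anti u y ∈ c → y ∈ b) := by
  have hL : (Lam b c u : ℤ) ≤ N c u := by exact_mod_cast Lam_le_N_right b c u
  have hN0 : (0 : ℤ) ≤ N (b ∩ c) u := Nat.cast_nonneg _
  have hsub : ((link u).filter fun y => y ∈ b ∧ anti u y ∈ c) ⊆ ((link u).filter fun y => anti u y ∈ c) := by
    intro y hy
    rw [mem_filter] at hy ⊢
    exact ⟨hy.1, hy.2.2⟩
  rw [Phi_of_mem_of_not_mem hb hc]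
  constructor
  · intro h
    have hN : N (b ∩ c) u = 0 := by
      have : (N (b ∩ c) u : ℤ) = 0 := by linarith
      exact_mod_cast this
    have hLN : Lam b c u = N c u := by
      have : (Lam b c u : ℤ) = N c u := by linarith
      exact_mod_cast this
    refine ⟨fun y hy hmem => (N_eq_zero_iff (b ∩ c) u).1 hN y hy (mem_inter.2 hmem), fun y hy hyc => ?_⟩
    have hcard : ((link u).filter fun y => anti u y ∈ c).card ≤ ((link u).filter fun y => y ∈ b ∧ anti u y ∈ c).card := by
      rw [card_filter_anti_mem, ← hLN]; exact le_rfl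
    have heq := Finset.eq_of_subset_of_card_le hsub hcard
    have hy' : y ∈ (link u).filter fun y => anti u y ∈ c := mem_filter.2 ⟨hy, hyc⟩
    rw [← heq, mem_filter] at hy'
    exact hy'.2.1
  · rintro ⟨h1, h2⟩
    have hN : N (b ∩ c) u = 0 := (N_eq_zero_iff (b ∩ c) u).2 fun y hy hmem => h1 y hy (mem_inter.1 hmem)
    have hLN : Lam b c u = N c u := by
      rw [← card_filter_anti_mem c u, Lam]
      congr 1
      ext y
      simp only [mem_filter]
      exact ⟨fun h => ⟨h.1, h.2.2⟩, fun h => ⟨h.1, h2 y h.1 h.2, h.2⟩⟩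
    rw [hN, hLN]; push_cast; ring

/-- **Lemma A, closed form, outer cell**: for `u ∉ b ∪ c`, `Φ_{bc}(u) = Λ_{bc}(u) − N_{b∩c}(u)` (minus Kleitman's gap of the two traces on
the link). [this work] -/
theorem Phi_of_not_mem_of_not_mem {b c : Finset (Pt ι)} {u : Pt ι} (hb : u ∉ b) (hc : u ∉ c) :
    Phi b c u = (Lam b c u : ℤ) - N (b ∩ c) u := by
  rw [Phi_eq, ind_of_not_mem hb, ind_of_not_mem hc]; ring

/-- For `u ∉ b ∪ c`: `Φ_{bc}(u) = 0 ⟺ Λ_{bc}(u) = N_{b∩c}(u)` (zero Kleitman gap on the link). [this work] -/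
theorem Phi_eq_zero_iff_of_not_mem_of_not_mem {b c : Finset (Pt ι)} {u : Pt ι} (hb : u ∉ b) (hc : u ∉ c) :
    Phi b c u = 0 ↔ Lam b c u = N (b ∩ c) u := by
  rw [Phi_of_not_mem_of_not_mem hb hc, sub_eq_zero]
  exact Int.natCast_inj

/-- The antipodal image of `…AntipodalHarris` is the `refl` of `…SahiCombFiveUpSet` (both are `map compl`). [this work] -/
theorem antipode_eq_refl (𝒜 : Finset (Finset ι)) : AntipodalHarris.antipode 𝒜 = FiveUpSet.refl 𝒜 := rfl

/-- Inessentiality of an axis for a trace family, unfolded: `i` is inessential for `fam u s` iff toggling the axis `i` between its two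
admissible levels never changes membership of a link point in `s`. [this work] -/
theorem inessential_fam_iff (u : Pt ι) (s : Finset (Pt ι)) (i : ι) :
    FiveUpSet.Inessential i (fam u s) ↔ ∀ S : Finset ι, i ∉ S → (ofSet u (insert i S) ∈ s ↔ ofSet u S ∈ s) := by
  simp only [FiveUpSet.Inessential, mem_fam]

/-- **EQUALITY CASE OF LEMMA A, outer cell** (all `d`): for UP-sets `b, c` and `u ∉ b ∪ c`, if `Φ_{bc}(u) = 0` then every axis is
inessential for the trace of `b` or for the trace of `c` on the link of `u` (equality in Harris–Kleitman on the link cube; the tree's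
`FiveUpSet.inessential_or_of_kleitman_eq`). [this work] -/
theorem inessential_or_of_Phi_eq_zero {b c : Finset (Pt ι)} (hb : IsUpperSet (b : Set (Pt ι)))
    (hc : IsUpperSet (c : Set (Pt ι))) {u : Pt ι} (hub : u ∉ b) (huc : u ∉ c) (h0 : Phi b c u = 0) (i : ι) :
    FiveUpSet.Inessential i (fam u b) ∨ FiveUpSet.Inessential i (fam u c) := by
  have hLN := (Phi_eq_zero_iff_of_not_mem_of_not_mem hub huc).1 h0
  refine FiveUpSet.inessential_or_of_kleitman_eq (isUpperSet_fam u hb) (isUpperSet_fam u hc) ?_ i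
  rw [← antipode_eq_refl, card_fam_inter_antipode, fam_inter, card_fam, hLN]

/-! ## §2  Rigidity of zeros under FBP: every available move is cost-free -/

/-- **Zero-cost R-move.**  Under FBP, at a zero of `κ` every minimal element of `a` lying in `b ∩ c` has charge `0` and its removal gives a
zero. [this work] -/
theorem Phi_eq_zero_of_isMinOf (hL : LatinPos ι) {a b c : Finset (Pt ι)} (hup : UpTriple a b c) (h0 : kappa a b c = 0)
    {m : Pt ι} (hm : IsMinOf a m) (hmb : m ∈ b) (hmc : m ∈ c) :
    Phi b c m = 0 ∧ kappa (a.erase m) b c = 0 := by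
  have h1 : kappa a b c = kappa (a.erase m) b c + Phi b c m := kappa_eq_kappa_erase_add hm.1 b c
  have h2 : 0 ≤ Phi b c m := Phi_nonneg_of_mem b c hmb hmc
  have h3 : 0 ≤ kappa (a.erase m) b c := hL _ _ _ ⟨isUpperSet_erase_of_minimal hup.1 hm.2, hup.2.1, hup.2.2⟩
  constructor <;> linarith

/-- Hence, under FBP, at a zero the whole LINK of every minimal element of `a` lying in `b ∩ c` lies in `b ∩ c`. [this work] -/
theorem link_subset_of_isMinOf_of_zero (hL : LatinPos ι) {a b c : Finset (Pt ι)} (hup : UpTriple a b c)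
    (h0 : kappa a b c = 0) {m : Pt ι} (hm : IsMinOf a m) (hmb : m ∈ b) (hmc : m ∈ c) :
    ∀ y ∈ link m, y ∈ b ∧ y ∈ c :=
  (Phi_eq_zero_iff_of_mem hmb hmc).1 (Phi_eq_zero_of_isMinOf hL hup h0 hm hmb hmc).1

/-- **Zero-cost A-move.**  Under FBP, at a zero of `κ` every maximal non-element of `a` outside `b ∩ c` has charge `0` and its insertion
gives a zero. [this work] -/
theorem Phi_eq_zero_of_isMaxOut (hL : LatinPos ι) {a b c : Finset (Pt ι)} (hup : UpTriple a b c) (h0 : kappa a b c = 0)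
    {m : Pt ι} (hm : IsMaxOut a m) (hnot : ¬ (m ∈ b ∧ m ∈ c)) :
    Phi b c m = 0 ∧ kappa (insert m a) b c = 0 := by
  have h1 : kappa (insert m a) b c = kappa a b c + Phi b c m := kappa_insert hm.1 b c
  have h2 : Phi b c m ≤ 0 := Phi_nonpos_of_not_mem hup.2.1 hup.2.2 hnot
  have h3 : 0 ≤ kappa (insert m a) b c := hL _ _ _ ⟨isUpperSet_insert_of_maximal hup.1 hm.2, hup.2.1, hup.2.2⟩
  constructor <;> linarith

/-- Hence, under FBP, at a zero a maximal non-element of `a` lying outside `b ∪ c` has traces of `b` and `c` on its link with no common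
essential axis. [this work] -/
theorem inessential_or_of_isMaxOut_of_zero (hL : LatinPos ι) {a b c : Finset (Pt ι)} (hup : UpTriple a b c)
    (h0 : kappa a b c = 0) {m : Pt ι} (hm : IsMaxOut a m) (hmb : m ∉ b) (hmc : m ∉ c) (i : ι) :
    FiveUpSet.Inessential i (fam m b) ∨ FiveUpSet.Inessential i (fam m c) :=
  inessential_or_of_Phi_eq_zero hup.2.1 hup.2.2 hmb hmc (Phi_eq_zero_of_isMaxOut hL hup h0 hm fun h => hmb h.1).1 i

/-- And a maximal non-element of `a` lying in `b ∖ c` has no link point in `b ∩ c`, while every link point whose completion lies in `c`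
lies in `b`. [this work] -/
theorem link_structure_of_isMaxOut_of_zero (hL : LatinPos ι) {a b c : Finset (Pt ι)} (hup : UpTriple a b c)
    (h0 : kappa a b c = 0) {m : Pt ι} (hm : IsMaxOut a m) (hmb : m ∈ b) (hmc : m ∉ c) :
    (∀ y ∈ link m, ¬ (y ∈ b ∧ y ∈ c)) ∧ (∀ y ∈ link m, anti m y ∈ c → y ∈ b) :=
  (Phi_eq_zero_iff_of_mem_of_not_mem hmb hmc).1 (Phi_eq_zero_of_isMaxOut hL hup h0 hm fun h => hmc h.2).1


end Summit.CriticalPhenomena.PercolationContinuityZ3.Theorems.SahiLatin
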